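import Summits.Ventures.LatticeQCDFlow.Scaling.ReplicaExchangeBareSampler
import Summits.Ventures.LatticeQCDFlow.Scaling.ReplicaExchangeModeTorpid

/-!
HONEST FRAMING: exact (Metropolis-corrected) sampling algorithms for lattice gauge theory; figures
of merit are autocorrelation/cost numbers at stated couplings and volumes; no continuum-physics
claim.

# ReplicaExchangeBareTorpid — THE TAGGED SAMPLER LUMPS ONTO THE TAGLESS ONE: EQUAL FLOWS, EQUAL DIRICHLET FORMS OF
# CONFIGURATION OBSERVABLES, HENCE THE CONVERSE OF CHAPTER R FOR THE SAME OBJECT —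
# `Gap(ptBareSampler t μ M) ≤ (1−t)·Σ_k Q_k(A,Aᶜ)/((K+1)·Σ_k μ_k(A)μ_k(Aᶜ))` (lean-2 GEN-18, ours)

Venture-side (OURS).  Cell `lqcd-flow` (pub-lqcd), unit `pub-lqcd-lean-2-g18`, 2026-08-25.  Chapter R, file 9.  GEN-17's
torpid companion `Scaling/ReplicaExchangeModeTorpid` (Z1) bounds the gap of the TAGGED sampler `ptFinSampler` by the
ladder-averaged sector exit flow, using the centred sector count `G(x) = Σ_k f_A^{(μ_k)}(x_k)` — an observable of the
configurations alone.  Here the tagged sampler is shown to LUMP onto the tagless `ptBareSampler` of chapter R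
(`Scaling/ReplicaExchangeBareSampler`) at the level of stationary flows, so that the Dirichlet form, mean and norm of
any configuration observable agree; Z1's Rayleigh quotient then caps the gap of the tagless sampler too.  With
`Scaling/ReplicaExchangeModeGap` this makes chapter R two-sided for one object: NO sector-crossing replica ⇒ no gain
(`Gap ≤` the ladder-averaged exit flow); ONE sector-crossing (hot) replica + persistence + overlaps ⇒ polynomial gain.

## What is proved

* §1 `sum_ptFinProposal_fst` — `Σ_{τ′} T((τ,x),(τ′,y)) = T_bare(x,y)`; **`sum_ptFinLaw_mul_ptFinSampler`** — for `y ≠ x`,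
  `Σ_{τ′} π(τ,x)·P((τ,x),(τ′,y)) = (K+1)⁻¹·π̃(x)·P_bare(x,y)` (`0 ≤ t ≤ 1`).
* §2 **`ptFin_dirichletForm_comp_snd`** — `𝓔_π(P; g∘snd) = 𝓔_π̃(P_bare; g)` for every configuration observable `g`;
  `ptFin_piInner_comp_snd`, `ptFin_mean_comp_snd`.
* §3 **`ptBare_spectralGap_le_sector`** — `Gap(ptBareSampler t μ M) ≤ (1−t)Σ_kQ_k(A,Aᶜ)/((K+1)Σ_kμ_k(A)μ_k(Aᶜ))` for
  every set of configurations uncertain at some level (`K ≥ 1`, `|S| ≥ 2`).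

NOT CLAIMED: lumping of asymptotic variances (needs the fundamental matrix); anything measured.  Literature grade
(cell rule): TEXTBOOK (lumpability, Kemeny–Snell §6.3) + GEN-17's mechanism; NEW TYPING; no new bib keys.
-/

noncomputable section

open Finset Function
open Literature.Probability.MarkovChains

namespace Summit.Ventures.LatticeQCDFlow.Scaling

section Lump

variable {S : Type*} [Fintype S] [DecidableEq S] {K : ℕ} {μ : Fin (K + 1) → S → ℝ}
  {M : Fin (K + 1) → S → S → ℝ} {t : ℝ}

/-! ## §1 Flows lump -/

omit [Fintype S] in
/-- **The swap proposals lump:** `Σ_{τ′} T((τ,x),(τ′,y)) = T_bare(x,y)` — for each pair `j` exactly one tag position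
`σ_jτ` is proposed together with `x∘σ_j`. [ours] -/
theorem sum_ptFinProposal_fst (τ : Fin (K + 1)) (x y : Fin (K + 1) → S) :
    ∑ τ' : Fin (K + 1), ptFinProposal (τ, x) (τ', y) = ptBareProposal x y := by
  unfold ptFinProposal ptBareProposal swapAct
  dsimp only
  rw [Finset.sum_comm]
  refine sum_congr rfl fun j _ => ?_
  by_cases hy : y = x ∘ levelSwap j
  · rw [if_pos hy]
    rw [Finset.sum_eq_single (levelSwap j τ)]
    · rw [if_pos (by rw [hy])]
    · intro τ' _ hτ'
      rw [if_neg]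
      intro h
      exact hτ' (Prod.mk.inj h).1
    · intro h; exact absurd (mem_univ _) h
  · rw [if_neg hy]
    exact sum_eq_zero fun τ' _ => if_neg fun h => hy (Prod.mk.inj h).2

/-- **Stationary flows lump:** for `y ≠ x`, `Σ_{τ′} π(τ,x)·P((τ,x),(τ′,y)) = (K+1)⁻¹·π̃(x)·P_bare(x,y)`. [ours] -/
theorem sum_ptFinLaw_mul_ptFinSampler (hμ : ∀ k x, 0 < μ k x) (τ : Fin (K + 1)) {x y : Fin (K + 1) → S}
    (hyx : y ≠ x) :
    ∑ τ' : Fin (K + 1), ptFinLaw μ (τ, x) * ptFinSampler t μ M (τ, x) (τ', y)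
      = tensorFun μ x * ptBareSampler t μ M x y / (K + 1) := by
  -- split both samplers into swap and update parts
  have e1 : ∀ (τ' : Fin (K + 1)) (z : Fin (K + 1) → S), ptFinLaw μ (τ', z) = tensorFun μ z / (K + 1) :=
    fun _ _ => rfl
  have hsw : ∀ τ', ptFinLaw μ (τ, x) * ptFinSwap μ (τ, x) (τ', y)
      = ptFinProposal (τ, x) (τ', y) * min (tensorFun μ x) (tensorFun μ y) / (K + 1) := by
    intro τ'
    have hq : ((τ', y) : Fin (K + 1) × (Fin (K + 1) → S)) ≠ (τ, x) := fun h => hyx (Prod.mk.inj h).2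
    rw [ptFinLaw_mul_ptFinSwap hμ hq, e1, e1, min_div_div_right (by positivity : (0 : ℝ) ≤ (K : ℝ) + 1)]
    ring
  have hup : ∀ τ', ptFinLaw μ (τ, x) * ptFinUpdate M (τ, x) (τ', y)
      = (if τ' = τ then tensorFun μ x * prodKernel (fun _ : Fin (K + 1) => (1 : ℝ) / (K + 1)) M x y / (K + 1)
        else 0) := by
    intro τ'
    rw [ptFinUpdate_apply, e1]
    dsimp only
    split_ifs with h
    · ring
    · ring
  calc ∑ τ' : Fin (K + 1), ptFinLaw μ (τ, x) * ptFinSampler t μ M (τ, x) (τ', y)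
      = ∑ τ' : Fin (K + 1), (t * (ptFinLaw μ (τ, x) * ptFinSwap μ (τ, x) (τ', y))
          + (1 - t) * (ptFinLaw μ (τ, x) * ptFinUpdate M (τ, x) (τ', y))) :=
        sum_congr rfl fun τ' _ => by rw [ptFinSampler_apply]; ring
    _ = t * (ptBareProposal x y * min (tensorFun μ x) (tensorFun μ y) / (K + 1))
        + (1 - t) * (tensorFun μ x * prodKernel (fun _ : Fin (K + 1) => (1 : ℝ) / (K + 1)) M x y / (K + 1)) := by
        have H1 : ∑ τ' : Fin (K + 1), t * (ptFinLaw μ (τ, x) * ptFinSwap μ (τ, x) (τ', y))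
            = t * (ptBareProposal x y * min (tensorFun μ x) (tensorFun μ y) / (K + 1)) := by
          rw [← mul_sum, Finset.sum_congr rfl fun τ' _ => hsw τ', ← sum_div, ← sum_mul, sum_ptFinProposal_fst]
        have H2 : ∑ τ' : Fin (K + 1), (1 - t) * (ptFinLaw μ (τ, x) * ptFinUpdate M (τ, x) (τ', y))
            = (1 - t) * (tensorFun μ x * prodKernel (fun _ : Fin (K + 1) => (1 : ℝ) / (K + 1)) M x y / (K + 1)) := by
          rw [← mul_sum, Finset.sum_congr rfl fun τ' _ => hup τ', sum_ite_eq' univ τ, if_pos (mem_univ _)]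
        rw [sum_add_distrib, H1, H2]
    _ = tensorFun μ x * ptBareSampler t μ M x y / (K + 1) := by
        rw [ptBareSampler_apply, mul_add, ← mul_assoc, mul_comm (tensorFun μ x) t, mul_assoc,
          tensorFun_mul_ptBareSwap hμ hyx]
        ring

/-! ## §2 Dirichlet forms, norms and means of configuration observables -/

/-- **`𝓔_π(P; g∘snd) = 𝓔_π̃(P_bare; g)`** for every observable of the replica configurations. [ours] -/
theorem ptFin_dirichletForm_comp_snd (hμ : ∀ k x, 0 < μ k x) (g : (Fin (K + 1) → S) → ℝ) :
    dirichletForm (ptFinLaw μ) (ptFinSampler t μ M) (fun p => g p.2)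
      = dirichletForm (tensorFun μ) (ptBareSampler t μ M) g := by
  unfold dirichletForm
  congr 1
  rw [Fintype.sum_prod_type]
  -- for each `(τ, x)`: sum over `(τ', y)`, diagonal-in-`y` terms vanish
  have inner : ∀ (τ : Fin (K + 1)) (x : Fin (K + 1) → S),
      ∑ q : Fin (K + 1) × (Fin (K + 1) → S), ptFinLaw μ (τ, x) * ptFinSampler t μ M (τ, x) q * (g x - g q.2) ^ 2
        = ∑ y, tensorFun μ x * ptBareSampler t μ M x y / (K + 1) * (g x - g y) ^ 2 := by
    intro τ x
    rw [Fintype.sum_prod_type, Finset.sum_comm]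
    refine sum_congr rfl fun y _ => ?_
    dsimp only
    by_cases hyx : y = x
    · subst hyx; simp
    · rw [← sum_mul, sum_ptFinLaw_mul_ptFinSampler hμ τ hyx]
  simp_rw [inner]
  rw [Finset.sum_const, Finset.card_univ, Fintype.card_fin, nsmul_eq_mul]
  rw [Finset.mul_sum]
  refine sum_congr rfl fun x _ => ?_
  rw [Finset.mul_sum]
  refine sum_congr rfl fun y _ => ?_
  push_cast
  field_simp

omit [DecidableEq S] in
/-- `⟨g∘snd, g∘snd⟩_π = ⟨g, g⟩_π̃`. [ours] -/
theorem ptFin_piInner_comp_snd [DecidableEq S] (g : (Fin (K + 1) → S) → ℝ) :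
    piInner (ptFinLaw μ) (fun p => g p.2) (fun p => g p.2) = piInner (tensorFun μ) g g := by
  unfold piInner
  exact sum_ptFinLaw_mul_snd (μ := μ) (fun x => g x * g x)

/-! ## §3 The converse for the tagless sampler -/

/-- **THE GAP CEILING FOR THE TAGLESS REPLICA-EXCHANGE SAMPLER:**
`Gap(ptBareSampler t μ M) ≤ (1−t)·Σ_k Q_k(A,Aᶜ)/((K+1)·Σ_k μ_k(A)μ_k(Aᶜ))` for every set of configurations uncertain at
some level — tempering in any schedule imports tunnelling, it never creates it. [ours] -/
theorem ptBare_spectralGap_le_sector [Nontrivial S] (hμ : ∀ k x, 0 < μ k x) (hμ1 : ∀ k, ∑ u, μ k u = 1)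
    (hM : ∀ k, IsRowStochastic (M k)) (hMrev : ∀ k, DetailedBalance (μ k) (M k)) (ht0 : 0 ≤ t) (ht1 : t ≤ 1)
    (A : Finset S) (hA : 0 < ∑ k, (∑ x ∈ A, μ k x) * ∑ x ∈ Aᶜ, μ k x) :
    spectralGap (tensorFun μ) (ptBareSampler t μ M)
      ≤ (1 - t) * (∑ k, edgeMeasure (μ k) (M k) A Aᶜ) / ((K + 1) * ∑ k, (∑ x ∈ A, μ k x) * ∑ x ∈ Aᶜ, μ k x) := by
  have hP := ptBareSampler_isRowStochastic (M := M) hμ hM ht0 ht1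
  have hDB := ptBareSampler_detailedBalance (t := t) (M := M) hμ hMrev
  have hmean : ∑ x, tensorFun μ x * (∑ k, bottleneckTestFun (μ k) A (x k)) = 0 := by
    rw [← sum_ptFinLaw_mul_snd (μ := μ) (fun x => ∑ k, bottleneckTestFun (μ k) A (x k))]
    exact ptFin_mean_sectorCount (μ := μ) hμ1 A
  have hray := LevinPeres2017_lemma_13_7_rayleigh (tensorFun_pos hμ) (sum_tensorFun_eq_one μ hμ1) hP hDB hmean
  rw [← ptFin_piInner_comp_snd (μ := μ) (fun x => ∑ k, bottleneckTestFun (μ k) A (x k)),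
    ← ptFin_dirichletForm_comp_snd (t := t) (M := M) hμ (fun x => ∑ k, bottleneckTestFun (μ k) A (x k)),
    ptFin_piInner_sectorCount hμ1, ptFin_dirichletForm_sectorCount hμ hμ1 hM hMrev] at hray
  rw [le_div_iff₀ (by positivity)]
  have hK1 : (0 : ℝ) < K + 1 := by positivity
  calc spectralGap (tensorFun μ) (ptBareSampler t μ M) * ((K + 1) * ∑ k, (∑ x ∈ A, μ k x) * ∑ x ∈ Aᶜ, μ k x)
      = (K + 1) * (spectralGap (tensorFun μ) (ptBareSampler t μ M)
          * ∑ k, (∑ x ∈ A, μ k x) * ∑ x ∈ Aᶜ, μ k x) := by ring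
    _ ≤ (K + 1) * ((1 - t) / (K + 1) * ∑ k, edgeMeasure (μ k) (M k) A Aᶜ) :=
        mul_le_mul_of_nonneg_left hray hK1.le
    _ = (1 - t) * ∑ k, edgeMeasure (μ k) (M k) A Aᶜ := by field_simp

end Lump

end Summit.Ventures.LatticeQCDFlow.Scaling
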